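import Mathlib.Analysis.SpecialFunctions.Pow.Real
import Mathlib.NumberTheory.Padics.HeightOneSpectrum
import Literature.NumberTheory.GaloisRepresentations.IntegralGaloisAction
import HarnessLib

/-!
# The Chebotarev density theorem over `ℚ` (Dirichlet-density form)

Neukirch, *Algebraic Number Theory*, Ch. VII, (13.1) (Dirichlet density) and Thm. (13.4)
(Čebotarev), vendored as a named fact (D-0014) for the base field `ℚ`, in the language of the
absolute Galois group `Γ_ℚ = Field.absoluteGaloisGroup ℚ` used throughout
`Literature.NumberTheory.GaloisRepresentations` (inertia groups `Ideal.inertia` and arithmetic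
Frobenii `IsArithFrobAt` at the primes `𝔓` of `\bar ℤ = absIntegers (𝓞 ℚ) ℚ` above `p`,
`HeightOneSpectrum.primesAbove`; rational primes are identified with `HeightOneSpectrum (𝓞 ℚ)`
by Mathlib's `Rat.HeightOneSpectrum.primesEquiv`).

* `Literature.HasDirichletDensity X d` — the set `X` of rational primes has Dirichlet density `d`:
  `(∑_{p ∈ X} p^{-s}) / log (1/(s-1)) → d` as `s → 1⁺` (Neukirch VII (13.1), second form, using
  `∑_p p^{-s} ∼ log (1/(s-1))`; Serre, *Cours d'arithmétique*, VI.4.1; this is the normalisation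
  of Deligne–Serre 1974, (5.4.1), whose `limsup` version is `Literature.NumberTheory.EllipticCurves.ModularForms.upperDensity`).
* `Literature.Chebotarev.frobPrimes φ C` — for a homomorphism `φ : Γ_ℚ → G` onto a finite group (with
  open kernel, i.e. `φ` is the restriction map to `Gal(L/ℚ)` for the finite Galois extension
  `L = \bar ℚ^{ker φ}`) and a subset `C ⊆ G` stable under conjugation: the set of primes `p`
  unramified in `L` (`φ` kills every inertia group `I_𝔓`, `𝔓 ∣ p`) whose Frobenius class lies in
  `C` (`φ(Frob_𝔓) ∈ C` for every arithmetic Frobenius at every `𝔓 ∣ p`).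
* `Literature.NumberTheory.LFunctions.Chebotarev.dirichletDensity_eq` — **the named fact**: `frobPrimes φ C` has Dirichlet
  density `|C| / |G|`.

Why this is Neukirch's (13.4): there `L|K` is a finite Galois extension with group `G`, and for
`σ ∈ G` the set `P_{L|K}(σ)` of primes `𝔭` of `K` unramified in `L` admitting a prime `𝔓 ∣ 𝔭` of
`L` with Frobenius `σ` (equivalently: whose Frobenius conjugacy class is `⟨σ⟩`) has Dirichlet
density `d(P_{L|K}(σ)) = #⟨σ⟩ / #G`; the sets `P_{L|K}(σ)` for non-conjugate `σ` are disjoint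
(loc. cit., p. 545), so for a union `C` of conjugacy classes the density is `#C / #G` by
additivity of the limit (as used in loc. cit. (13.6)). For `K = ℚ` and `L = \bar ℚ^{ker φ}`:
`G ≅ Γ_ℚ / ker φ = Gal(L/ℚ)`; the inertia (resp. an arithmetic Frobenius) of `𝔓 ∩ L` in
`Gal(L/ℚ)` is the image of the inertia group (resp. of any arithmetic Frobenius) of `𝔓` in `Γ_ℚ`
(functoriality of inertia and Frobenius under `\bar ℚ ⊇ L`, Serre, *Corps locaux*, I §7,
Prop. 22), so "`p` unramified in `L` with Frobenius class in `C`" is exactly the membership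
condition of `frobPrimes`. Mathlib has Dirichlet's theorem on primes in arithmetic progressions
but neither Artin `L`-functions nor the Chebotarev density theorem (searched `Chebotarev`,
`Cebotarev`, `density` in `Mathlib/NumberTheory`), hence a named fact.

## References

* J. Neukirch, *Algebraic Number Theory*, Grundlehren 322, Springer (1999), Ch. VII, (13.1),
  Thm. (13.4), pp. 542–545.
* J.-P. Serre, *Cours d'arithmétique*, PUF (1970), Ch. VI, §4.1.
* P. Deligne, J.-P. Serre, *Formes modulaires de poids 1*, Ann. Sci. ÉNS (4) 7 (1974), (5.4.1)
  and Lemme 8.3 (the use made of the theorem).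
-/

noncomputable section

open scoped NumberField Topology

open Filter IsDedekindDomain Rat.HeightOneSpectrum

namespace Literature.NumberTheory.LFunctions

open Classical in
/-- The set `X` of rational primes **has Dirichlet density `d`**:
`(∑_{p ∈ X, p prime} p^{-s}) / log (1/(s - 1)) → d` as `s → 1`, `s > 1` (non-primes in `X` are
ignored). This is Neukirch's second expression for the Dirichlet density (VII (13.1), using
`∑_p p^{-s} ∼ log (1/(s-1))`) and Serre's definition (*Cours d'arithmétique* VI.4.1); its
`limsup` variant is Deligne–Serre's `dens.sup` (1974, (5.4.1)). [cite: NeukirchANT1999, VII (13.1)] -/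
def HasDirichletDensity (X : Set ℕ) (d : ℝ) : Prop :=
  Tendsto (fun s : ℝ ↦
    (∑' p : ℕ, if p.Prime ∧ p ∈ X then (p : ℝ) ^ (-s) else 0) / Real.log (1 / (s - 1)))
    (𝓝[>] (1 : ℝ)) (𝓝 d)

open Classical in
/-- Unfolding lemma for `HasDirichletDensity`. [folklore] -/
lemma hasDirichletDensity_iff {X : Set ℕ} {d : ℝ} :
    HasDirichletDensity X d ↔ Tendsto (fun s : ℝ ↦
      (∑' p : ℕ, if p.Prime ∧ p ∈ X then (p : ℝ) ^ (-s) else 0) / Real.log (1 / (s - 1)))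
      (𝓝[>] (1 : ℝ)) (𝓝 d) :=
  Iff.rfl

/-- The Dirichlet density of a set of primes, when it exists, is unique. [folklore] -/
lemma HasDirichletDensity.unique {X : Set ℕ} {d d' : ℝ} (h : HasDirichletDensity X d)
    (h' : HasDirichletDensity X d') : d = d' :=
  tendsto_nhds_unique h h'

open Classical in
/-- The Dirichlet density only depends on the primes in `X`. [folklore] -/
lemma hasDirichletDensity_congr {X Y : Set ℕ} (hXY : ∀ p : ℕ, p.Prime → (p ∈ X ↔ p ∈ Y))
    {d : ℝ} : HasDirichletDensity X d ↔ HasDirichletDensity Y d := by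
  have h : ∀ s : ℝ, (∑' p : ℕ, if p.Prime ∧ p ∈ X then (p : ℝ) ^ (-s) else (0 : ℝ)) =
      ∑' p : ℕ, if p.Prime ∧ p ∈ Y then (p : ℝ) ^ (-s) else 0 := fun s ↦
    tsum_congr fun p ↦ by
      by_cases hp : p.Prime
      · simp [hp, hXY p hp]
      · simp [hp]
  simp only [HasDirichletDensity, h]

universe u

namespace Chebotarev

variable {G : Type*} [Group G]

/-- For a homomorphism `φ : Γ_ℚ → G` and `C ⊆ G`: the set of rational primes `p` such that `φ` is
**unramified at `p`** (`φ` kills the inertia group `I_𝔓 ≤ Γ_ℚ` of every prime `𝔓` of `\bar ℤ`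
above `p`) and the **Frobenius class of `p` lies in `C`** (`φ σ ∈ C` for every arithmetic
Frobenius `σ` at every `𝔓 ∣ p`). When `φ` is the restriction map onto `G = Gal(L/ℚ)`, `L/ℚ`
finite Galois, and `C = ⟨σ⟩` is a conjugacy class, this is Neukirch's set `P_{L|ℚ}(σ)`.
[cite: NeukirchANT1999, VII §13, p. 545] -/
def frobPrimes (φ : Field.absoluteGaloisGroup ℚ →* G) (C : Set G) : Set ℕ :=
  {p | ∃ v : HeightOneSpectrum (𝓞 ℚ), ((primesEquiv v : Nat.Primes) : ℕ) = p ∧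
    (∀ 𝔓 ∈ v.primesAbove, ∀ σ ∈ 𝔓.inertia (Field.absoluteGaloisGroup ℚ), φ σ = 1) ∧
    (∀ 𝔓 ∈ v.primesAbove, ∀ σ : Field.absoluteGaloisGroup ℚ,
      IsArithFrobAt (𝓞 ℚ) σ 𝔓 → φ σ ∈ C)}

/-- Membership in `frobPrimes`, for the prime attached to a finite place `v` of `ℚ`. [folklore] -/
lemma primesEquiv_mem_frobPrimes_iff {φ : Field.absoluteGaloisGroup ℚ →* G} {C : Set G}
    {v : HeightOneSpectrum (𝓞 ℚ)} :
    ((primesEquiv v : Nat.Primes) : ℕ) ∈ frobPrimes φ C ↔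
      (∀ 𝔓 ∈ v.primesAbove, ∀ σ ∈ 𝔓.inertia (Field.absoluteGaloisGroup ℚ), φ σ = 1) ∧
      (∀ 𝔓 ∈ v.primesAbove, ∀ σ : Field.absoluteGaloisGroup ℚ,
        IsArithFrobAt (𝓞 ℚ) σ 𝔓 → φ σ ∈ C) := by
  constructor
  · rintro ⟨w, hw, h⟩
    have : w = v := primesEquiv.injective (Subtype.ext hw)
    subst this
    exact h
  · exact fun h ↦ ⟨v, rfl, h⟩

/-- Every element of `frobPrimes φ C` is a prime number. [folklore] -/
lemma prime_of_mem_frobPrimes {φ : Field.absoluteGaloisGroup ℚ →* G} {C : Set G} {p : ℕ}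
    (hp : p ∈ frobPrimes φ C) : p.Prime := by
  obtain ⟨v, rfl, -⟩ := hp
  exact (primesEquiv v).2

/-- `frobPrimes` is monotone in `C`. [folklore] -/
lemma frobPrimes_mono (φ : Field.absoluteGaloisGroup ℚ →* G) {C C' : Set G} (h : C ⊆ C') :
    frobPrimes φ C ⊆ frobPrimes φ C' := by
  rintro p ⟨v, rfl, hunr, hfrob⟩
  exact ⟨v, rfl, hunr, fun 𝔓 h𝔓 σ hσ ↦ h (hfrob 𝔓 h𝔓 σ hσ)⟩

/-- **Chebotarev density theorem** over `ℚ`, Dirichlet-density form (Neukirch VII, Thm. (13.4)).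
Let `φ : Gal(ℚ̄/ℚ) → G` be a surjective homomorphism onto a finite group with open kernel (so
`G = Gal(L/ℚ)` for the finite Galois extension `L = ℚ̄^{ker φ}`), and let `C ⊆ G` be stable under
conjugation. Then the set of primes `p` unramified in `L` whose Frobenius class lies in `C` has
Dirichlet density `|C| / |G|`: for a single conjugacy class `C = ⟨σ⟩` this is (13.4) verbatim,
`d(P_{L|ℚ}(σ)) = #⟨σ⟩ / #G`, and the sets `P_{L|ℚ}(σ)` are disjoint for non-conjugate `σ`, so the
densities add over the classes contained in `C`. (For `p` unramified the images `φ σ` of the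
arithmetic Frobenii `σ` at the primes `𝔓 ∣ p` form one conjugacy class of `G` — the Frobenius
class of `p`, non-empty by `HeightOneSpectrum.exists_isArithFrobAt_of_mem_primesAbove` — so
"`φ σ ∈ C` for all such `σ`" says that this class is contained in, i.e. is one of the classes
of, `C`.) [cite: NeukirchANT1999, VII Thm. (13.4)] -/
def dirichletDensity_eq : Prop :=
  ∀ ⦃G : Type u⦄ [Group G] [Finite G] (φ : Field.absoluteGaloisGroup ℚ →* G),
    IsOpen ((φ.ker : Subgroup (Field.absoluteGaloisGroup ℚ)) : Set (Field.absoluteGaloisGroup ℚ)) →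
    Function.Surjective φ →
    ∀ C : Set G, (∀ g h : G, h ∈ C → g * h * g⁻¹ ∈ C) →
      HasDirichletDensity (frobPrimes φ C) ((Nat.card C : ℝ) / Nat.card G)

end Chebotarev

end Literature.NumberTheory.LFunctions
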